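import Literature.NumberTheory.DiophantineGeometry.AbcFermatCatalanProofs
import Mathlib.NumberTheory.Padics.PadicVal.Basic
import HarnessLib

/-!
# Darmon–Granville's Theorem 2 (abc.S18, `darmon_granville`): the elementary steps of the printed proof

`Literature.NumberTheory.DiophantineGeometry.darmon_granville` (`AbcWave0`) records Theorem 2 of
H. Darmon & A. Granville, *On the equations `z ^ m = F(x, y)` and `A x ^ p + B y ^ q = C z ^ r`*,
Bull. London Math. Soc. **27** (1995) 513–543, in the case `A = B = C = 1`: for a fixed hyperbolic
signature `(p, q, r)` (`1/p + 1/q + 1/r < 1`) the equation `x ^ p + y ^ q = z ^ r` has only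
finitely many solutions in pairwise coprime positive integers. The printed proof (§3, pp. 524–527)
attaches to a proper solution the parameter `t := A x ^ p / C z ^ r ∈ ℙ¹(K) ∖ {0, 1, ∞}` and runs:

1. (Prop. 3.1, p. 525; Riemann existence theorem) a Galois covering `π : X → ℙ¹` of signature
   `(p, q, r)` and degree `d`, defined over a number field `K`, of genus `g` with
   `2 g - 2 = d (1 - 1/p - 1/q - 1/r)` (Riemann–Hurwitz), so `g ≥ 2` in the hyperbolic case;
2. (Prop. 3.2, p. 526; Beckmann, J. reine angew. Math. **419** (1991)) if `v ∉ V` (bad places) and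
   `(t·0)_v ≡ 0 (mod p)`, `(t·1)_v ≡ 0 (mod q)`, `(t·∞)_v ≡ 0 (mod r)` — display (3.1), where
   `(t·0)_v = max(ord_v t, 0)`, `(t·1)_v = max(ord_v (t - 1), 0)`, `(t·∞)_v = max(ord_v (1/t), 0)` —
   then the field `L_t = K(π⁻¹(t))` is unramified at `v`;
3. (p. 526, last paragraph) for `t = A x ^ p / C z ^ r` coming from a proper solution the
   congruences (3.1) hold at every `v ∤ A B C`;
4. (p. 527) Minkowski (Hermite–Minkowski): finitely many fields of degree `≤ d` unramified outside
   `V_{ABC}`, so the compositum `L` of the `L_t` is a number field; Faltings: `X(L)` is finite; it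
   contains the `d` points of `π⁻¹(t)` for every such `t`, so there are finitely many `t`, hence
   finitely many proper solutions.

Steps 1 (existence of the covering), 2, and the two theorems quoted in 4 are not available in
Mathlib or `Literature/` (Faltings' theorem is the unproved named fact
`Literature.NumberTheory.DiophantineGeometry.finite_ratPlaces_of_two_le_genus`), so
`darmon_granville` stays a named fact. This file proves, sorry-free and without introducing any
definition or named fact, the ELEMENTARY steps of the argument for `A = B = C = 1`:

* `Literature.NumberTheory.DiophantineGeometry.dgParam_ne_zero`, `…dgParam_ne_one`,
  `…dgParam_sub_one`: `t = x ^ p / z ^ r` lies in `ℙ¹ ∖ {0, 1, ∞}` and `t - 1 = - y ^ q / z ^ r`;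
* `Literature.NumberTheory.DiophantineGeometry.max_padicValRat_pow_div_pow` and the three
  instances `…interZero_dgParam`, `…interOne_dgParam`, `…interInfty_dgParam`: for pairwise coprime
  positive `x, y, z` with `x ^ p + y ^ q = z ^ r` and every prime `ℓ`,
  `(t·0)_ℓ = p · ord_ℓ x`, `(t·1)_ℓ = q · ord_ℓ y`, `(t·∞)_ℓ = r · ord_ℓ z`, whence the congruences
  (3.1) at every prime (`…dvd_interZero_dgParam` & co.) — step 3;
* `Literature.NumberTheory.DiophantineGeometry.two_le_genus_of_riemannHurwitz_signature`: the
  arithmetic of the last case of Prop. 3.1 (`χ < 0 ⇒ g ≥ 2`) — the part of step 1 that is not the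
  Riemann existence theorem;
* `Literature.NumberTheory.DiophantineGeometry.dgParam_injOn` and
  `Literature.NumberTheory.DiophantineGeometry.darmon_granville_iff_finite_dgParam_image`: a
  solution is determined by its parameter `t` (as `gcd(x ^ p, z ^ r) = 1` the fraction is in lowest
  terms), so Theorem 2 (as vendored) is EQUIVALENT to the finiteness, for each hyperbolic signature,
  of the set of parameters `t` — the last sentence of the printed proof ("therefore there are only
  finitely many proper solutions").

Nothing here changes a statement of `AbcWave0`, and no definition is introduced: in the names,
`dgParam` stands for the parameter `t = x ^ p / z ^ r` of a solution `(x, y, z)` (written out as a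
term), and `interZero` / `interOne` / `interInfty` for the arithmetic intersection numbers
`(t·0)_ℓ`, `(t·1)_ℓ`, `(t·∞)_ℓ` of p. 526 (written out as `max (padicValRat ℓ _) 0`); the
valuation `ord_ℓ` on `ℚ` is Mathlib's `padicValRat ℓ` (with `padicValRat ℓ 0 = 0`, harmless here
since `t ≠ 0, 1`).
-/

namespace Literature.NumberTheory.DiophantineGeometry

/-! ### The parameter `t = x ^ p / z ^ r` (p. 526: "take `t = A x ^ p / C z ^ r`") -/

/-- For a solution with `x > 0` (and `z > 0`) the parameter `t = x ^ p / z ^ r` is non-zero.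
[cite: DarmonGranville1995, §3, proof of Theorem 2 (p. 526)] -/
theorem dgParam_ne_zero {x z : ℕ} (hx : 0 < x) (hz : 0 < z) (p r : ℕ) :
    (x : ℚ) ^ p / (z : ℚ) ^ r ≠ 0 :=
  div_ne_zero (pow_ne_zero _ (Nat.cast_ne_zero.mpr hx.ne')) (pow_ne_zero _ (Nat.cast_ne_zero.mpr hz.ne'))

/-- For a solution of `x ^ p + y ^ q = z ^ r` (with `z > 0`) the parameter satisfies
`t - 1 = -(y ^ q / z ^ r)` (p. 526: `t = A x ^ p / C z ^ r`, so that `t - 1 = -B y ^ q / C z ^ r`).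
[cite: DarmonGranville1995, §3, proof of Theorem 2 (p. 526)] -/
theorem dgParam_sub_one {x y z p q r : ℕ} (hz : 0 < z) (h : x ^ p + y ^ q = z ^ r) :
    (x : ℚ) ^ p / (z : ℚ) ^ r - 1 = -((y : ℚ) ^ q / (z : ℚ) ^ r) := by
  have hzr : (z : ℚ) ^ r ≠ 0 := pow_ne_zero _ (Nat.cast_ne_zero.mpr hz.ne')
  have hq : ((x : ℚ) ^ p + (y : ℚ) ^ q) = (z : ℚ) ^ r := by exact_mod_cast h
  field_simp
  linarith

/-- For a solution with `y > 0` the parameter `t = x ^ p / z ^ r` is not `1`, so that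
`t ∈ ℙ¹ ∖ {0, 1, ∞}`. [cite: DarmonGranville1995, §3, proof of Theorem 2 (p. 526)] -/
theorem dgParam_ne_one {x y z p q r : ℕ} (hy : 0 < y) (hz : 0 < z) (h : x ^ p + y ^ q = z ^ r) :
    (x : ℚ) ^ p / (z : ℚ) ^ r ≠ 1 := by
  intro h1
  have h0 := dgParam_sub_one (x := x) (p := p) hz h
  rw [h1, sub_self, zero_eq_neg] at h0
  exact dgParam_ne_zero hy hz q r h0

/-! ### The congruences (3.1) at every prime (Prop. 3.2 hypothesis; p. 526, last paragraph) -/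

/-- For coprime positive integers `a, b` and a prime `ℓ`, the "arithmetic intersection number"
`max(ord_ℓ (a ^ m / b ^ n), 0)` equals `m · ord_ℓ a`: if `ℓ ∣ a` then `ℓ ∤ b` and
`ord_ℓ (a ^ m / b ^ n) = m · ord_ℓ a ≥ 0`; otherwise it is `- n · ord_ℓ b ≤ 0`. [folklore] -/
theorem max_padicValRat_pow_div_pow {ℓ : ℕ} [Fact ℓ.Prime] {a b : ℕ} (ha : 0 < a) (hb : 0 < b)
    (hab : Nat.Coprime a b) (m n : ℕ) :
    max (padicValRat ℓ ((a : ℚ) ^ m / (b : ℚ) ^ n)) 0 = m * padicValNat ℓ a := by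
  have ha' : (a : ℚ) ^ m ≠ 0 := pow_ne_zero _ (Nat.cast_ne_zero.mpr ha.ne')
  have hb' : (b : ℚ) ^ n ≠ 0 := pow_ne_zero _ (Nat.cast_ne_zero.mpr hb.ne')
  rw [padicValRat.div ha' hb', padicValRat.pow, padicValRat.pow, padicValRat.of_nat,
    padicValRat.of_nat]
  by_cases hla : ℓ ∣ a
  · have hlb : ¬ ℓ ∣ b := fun hlb =>
      (Fact.out : ℓ.Prime).one_lt.ne' (Nat.eq_one_of_dvd_one (hab ▸ Nat.dvd_gcd hla hlb))
    rw [padicValNat.eq_zero_of_not_dvd hlb]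
    simp only [Nat.cast_zero, mul_zero, sub_zero, max_eq_left_iff]
    positivity
  · rw [padicValNat.eq_zero_of_not_dvd hla]
    simp only [Nat.cast_zero, mul_zero, zero_sub, max_eq_right_iff, Left.neg_nonpos_iff]
    positivity

/-- **(3.1) at `0`.** For pairwise coprime positive `x, z` and a prime `ℓ`, the parameter
`t = x ^ p / z ^ r` has `(t·0)_ℓ := max(ord_ℓ t, 0) = p · ord_ℓ x`.
[cite: DarmonGranville1995, §3, (3.1) and proof of Theorem 2 (pp. 526–527)] -/
theorem interZero_dgParam {ℓ : ℕ} [Fact ℓ.Prime] {x z : ℕ} (hx : 0 < x) (hz : 0 < z)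
    (hxz : Nat.Coprime x z) (p r : ℕ) :
    max (padicValRat ℓ ((x : ℚ) ^ p / (z : ℚ) ^ r)) 0 = p * padicValNat ℓ x :=
  max_padicValRat_pow_div_pow hx hz hxz p r

/-- **(3.1) at `1`.** For a solution of `x ^ p + y ^ q = z ^ r` in positive integers with `y, z`
coprime and a prime `ℓ`, the parameter `t = x ^ p / z ^ r` has
`(t·1)_ℓ := max(ord_ℓ (t - 1), 0) = q · ord_ℓ y` (because `t - 1 = - y ^ q / z ^ r`).
[cite: DarmonGranville1995, §3, (3.1) and proof of Theorem 2 (pp. 526–527)] -/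
theorem interOne_dgParam {ℓ : ℕ} [Fact ℓ.Prime] {x y z p q r : ℕ} (hy : 0 < y) (hz : 0 < z)
    (hyz : Nat.Coprime y z) (h : x ^ p + y ^ q = z ^ r) :
    max (padicValRat ℓ ((x : ℚ) ^ p / (z : ℚ) ^ r - 1)) 0 = q * padicValNat ℓ y := by
  rw [dgParam_sub_one hz h, padicValRat.neg]
  exact max_padicValRat_pow_div_pow hy hz hyz q r

/-- **(3.1) at `∞`.** For pairwise coprime positive `x, z` and a prime `ℓ`, the parameter
`t = x ^ p / z ^ r` has `(t·∞)_ℓ := max(ord_ℓ (1 / t), 0) = r · ord_ℓ z`.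
[cite: DarmonGranville1995, §3, (3.1) and proof of Theorem 2 (pp. 526–527)] -/
theorem interInfty_dgParam {ℓ : ℕ} [Fact ℓ.Prime] {x z : ℕ} (hx : 0 < x) (hz : 0 < z)
    (hxz : Nat.Coprime x z) (p r : ℕ) :
    max (padicValRat ℓ (1 / ((x : ℚ) ^ p / (z : ℚ) ^ r))) 0 = r * padicValNat ℓ z := by
  rw [one_div, inv_div]
  exact max_padicValRat_pow_div_pow hz hx hxz.symm r p

/-- **The congruences (3.1) hold at every prime** for `t = x ^ p / z ^ r` attached to a solution of
`x ^ p + y ^ q = z ^ r` in pairwise coprime positive integers (the case `A = B = C = 1` of "The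
congruences in (3.1) are satisfied if `v` does not divide `A`, `B` or `C`", p. 526):
`p ∣ (t·0)_ℓ`, `q ∣ (t·1)_ℓ` and `r ∣ (t·∞)_ℓ`.
[cite: DarmonGranville1995, §3, proof of Theorem 2 (pp. 526–527)] -/
theorem dvd_inter_dgParam {ℓ : ℕ} [Fact ℓ.Prime] {x y z p q r : ℕ} (hx : 0 < x) (hy : 0 < y)
    (hz : 0 < z) (hyz : Nat.Coprime y z) (hxz : Nat.Coprime x z) (h : x ^ p + y ^ q = z ^ r) :
    (p : ℤ) ∣ max (padicValRat ℓ ((x : ℚ) ^ p / (z : ℚ) ^ r)) 0 ∧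
      (q : ℤ) ∣ max (padicValRat ℓ ((x : ℚ) ^ p / (z : ℚ) ^ r - 1)) 0 ∧
      (r : ℤ) ∣ max (padicValRat ℓ (1 / ((x : ℚ) ^ p / (z : ℚ) ^ r))) 0 := by
  rw [interZero_dgParam hx hz hxz, interOne_dgParam hy hz hyz h, interInfty_dgParam hx hz hxz]
  exact ⟨dvd_mul_right _ _, dvd_mul_right _ _, dvd_mul_right _ _⟩

/-! ### Prop. 3.1, hyperbolic case: the Riemann–Hurwitz arithmetic (p. 525) -/

/-- **Riemann–Hurwitz for signature `(p, q, r)`, hyperbolic case.** If a covering of `ℙ¹` of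
degree `d ≥ 1` has signature `(p, q, r)`, its genus `g` satisfies
`2 g - 2 = d (1 - 1/p - 1/q - 1/r)` (p. 525); when `1/p + 1/q + 1/r < 1` (integer form
`q r + r p + p q < p q r`) this forces `g ≥ 2` ("If `χ(p, q, r) < 0`, then `g > 1`", Prop. 3.1).
Only this arithmetic is recorded (the identity cleared of denominators is the hypothesis `hRH`);
the existence of the covering is the Riemann existence theorem and is not available here.
[cite: DarmonGranville1995, Proposition 3.1 (p. 525)] -/
theorem two_le_genus_of_riemannHurwitz_signature {p q r d : ℕ} {g : ℤ}
    (hpqr : q * r + r * p + p * q < p * q * r) (hd : 0 < d)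
    (hRH : (2 * g - 2) * (p * q * r : ℕ) = d * ((p * q * r : ℕ) - (q * r + r * p + p * q : ℕ) : ℤ)) :
    2 ≤ g := by
  have h1 : (0 : ℤ) < (p * q * r : ℕ) - (q * r + r * p + p * q : ℕ) := by omega
  have h2 : (0 : ℤ) < (p * q * r : ℕ) := by omega
  have h3 : 0 < (2 * g - 2) * (p * q * r : ℕ) := hRH ▸ mul_pos (by exact_mod_cast hd) h1
  have h4 : 0 < 2 * g - 2 := (pos_iff_pos_of_mul_pos h3).mpr h2
  omega

/-! ### Last step (p. 527): a proper solution is determined by its parameter `t` -/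

/-- For positive `x, z, x', z'` with `gcd(x, z) = gcd(x', z') = 1`, equality of the parameters
`x ^ p / z ^ r = x' ^ p / z' ^ r` forces `x ^ p = x' ^ p` and `z ^ r = z' ^ r`: both fractions
are in lowest terms. [folklore] -/
theorem pow_eq_of_dgParam_eq {x z x' z' : ℕ} (hz : 0 < z) (hz' : 0 < z')
    (hxz : Nat.Coprime x z) (hxz' : Nat.Coprime x' z') {p r : ℕ}
    (h : (x : ℚ) ^ p / (z : ℚ) ^ r = (x' : ℚ) ^ p / (z' : ℚ) ^ r) :
    x ^ p = x' ^ p ∧ z ^ r = z' ^ r := by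
  have key := Rat.div_int_inj (a := ((x ^ p : ℕ) : ℤ)) (b := ((z ^ r : ℕ) : ℤ))
    (c := ((x' ^ p : ℕ) : ℤ)) (d := ((z' ^ r : ℕ) : ℤ))
    (by exact_mod_cast pow_pos hz r) (by exact_mod_cast pow_pos hz' r)
    (by simpa only [Int.natAbs_natCast] using Nat.Coprime.pow p r hxz)
    (by simpa only [Int.natAbs_natCast] using Nat.Coprime.pow p r hxz')
    (by push_cast; exact h)
  exact ⟨by exact_mod_cast key.1, by exact_mod_cast key.2⟩

/-- **A proper solution is determined by `t`.** On the solution set of `darmon_granville` for a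
signature `(p, q, r)` with `p, q, r ≠ 0` (pairwise coprime positive `x, y, z` with
`x ^ p + y ^ q = z ^ r`) the parameter map `(x, y, z) ↦ t = x ^ p / z ^ r` is injective: `t` in
lowest terms gives back `x ^ p` and `z ^ r`, hence `x`, `z`, and `y ^ q = z ^ r - x ^ p` gives `y`.
(This is the count behind the last sentence of the printed proof, p. 527: finitely many `t` give
finitely many proper solutions.) [cite: DarmonGranville1995, §3, proof of Theorem 2 (p. 527)] -/
theorem dgParam_injOn {p q r : ℕ} (hp : p ≠ 0) (hq : q ≠ 0) (hr : r ≠ 0) :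
    Set.InjOn (fun t : ℕ × ℕ × ℕ => (t.1 : ℚ) ^ p / (t.2.2 : ℚ) ^ r)
      {t : ℕ × ℕ × ℕ | 0 < t.1 ∧ 0 < t.2.1 ∧ 0 < t.2.2 ∧ Nat.Coprime t.1 t.2.1 ∧
        Nat.Coprime t.2.1 t.2.2 ∧ Nat.Coprime t.1 t.2.2 ∧ t.1 ^ p + t.2.1 ^ q = t.2.2 ^ r} := by
  rintro ⟨x, y, z⟩ ⟨-, -, hz, -, -, hxz, he⟩ ⟨x', y', z'⟩ ⟨-, -, hz', -, -, hxz', he'⟩ ht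
  obtain ⟨hxx, hzz⟩ := pow_eq_of_dgParam_eq hz hz' hxz hxz' ht
  obtain rfl : x = x' := Nat.pow_left_injective hp hxx
  obtain rfl : z = z' := Nat.pow_left_injective hr hzz
  obtain rfl : y = y' := Nat.pow_left_injective hq (by dsimp only at he he' ⊢; omega)
  rfl

/-- **Theorem 2 ⇔ finitely many parameters.** Darmon–Granville's Theorem 2 as vendored
(`darmon_granville`: for each hyperbolic signature, finitely many solutions of `x ^ p + y ^ q = z ^ r`
in pairwise coprime positive integers) is equivalent to: for each hyperbolic signature the set of
parameters `t = x ^ p / z ^ r ∈ ℚ` of such solutions is finite. The printed proof (p. 527)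
establishes exactly the latter (every such `t` has its fibre `π⁻¹(t)` inside the finite set
`X(L)`) and concludes by this equivalence; `←` is `dgParam_injOn`, `→` is trivial.
[cite: DarmonGranville1995, Theorem 2 and §3, proof of Theorem 2 (p. 527)] -/
theorem darmon_granville_iff_finite_dgParam_image :
    darmon_granville ↔ ∀ {p q r : ℕ}, q * r + r * p + p * q < p * q * r →
      ((fun t : ℕ × ℕ × ℕ => (t.1 : ℚ) ^ p / (t.2.2 : ℚ) ^ r) ''
        {t : ℕ × ℕ × ℕ | 0 < t.1 ∧ 0 < t.2.1 ∧ 0 < t.2.2 ∧ Nat.Coprime t.1 t.2.1 ∧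
          Nat.Coprime t.2.1 t.2.2 ∧ Nat.Coprime t.1 t.2.2 ∧ t.1 ^ p + t.2.1 ^ q = t.2.2 ^ r}).Finite := by
  constructor
  · intro h p q r hpqr
    exact (h hpqr).image _
  · intro h p q r hpqr
    obtain ⟨hp, hq, hr⟩ := hyperbolic_exponents_ne_zero hpqr
    exact Set.Finite.of_finite_image (h hpqr) (dgParam_injOn hp hq hr)

end Literature.NumberTheory.DiophantineGeometry
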